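import Literature.AnabelianGeometry.SemiGraphs.TemperedReconstructionCor39UpToTwistAssembly
import Literature.AnabelianGeometry.SemiGraphs.TemperedReconstructionR3SubCompatAt
import Literature.AnabelianGeometry.SemiGraphs.TemperedReconstructionR2bCompatProofsAt
import Literature.AnabelianGeometry.SemiGraphs.TemperedReconstructionR0CompatProofsAt
import Literature.AnabelianGeometry.SemiGraphs.TemperedReconstructionBaseUniquenessProofs
import Literature.AnabelianGeometry.SemiGraphs.TemperedThm37OfCompactInVerticialAt
import HarnessLib

/-!
# Corollary 3.9 (compatible reading, "induced" up to twist) — AT ONE PAIR OF GRAPHS (φ2 twin)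

Mochizuki, *Semi-graphs of anabelioids*, Publ. RIMS **42** (2006), §3, Cor. 3.9, proof pp. 42–43
[cite: MochizukiSemiAnbd2006, Cor 3.9 pp.42-43].

Companion of `TemperedReconstructionCor39UpToTwistAssembly.lean` (abc-iut-w4-d080) under the cell's
φ2-consumers programme (rulings φ2 / α4-3 / α5-3 of abc-iut-L3-lead).  The def-free Cor. 3.9 up to
twist is re-assembled AT ONE PAIR `(𝒢, ℋ)` with charts `(c𝒢, cℋ)`:
* `cor39UpToTwist_of_stepsAt` — from the three steps AT THE PAIR, taken as inline hypotheses: (R0′)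
  compatible ⇒ compatibly quasi-geometric, (R2′) compatibly quasi-geometric ⇒ graph data, (R3, `∃ θ`)
  compatible ⇒ induced up to twist; (b)-uniqueness needs NO input beyond Thm. 3.7 (i), (ii) (theorems
  of the tree): abc-iut-w4-d083's `base_eq_of_compatV`;
* `cor39UpToTwist_of_R0_R2At` — the same with (R3) discharged AT `ℋ` by abc-iut-w4-d064's per-graph
  `chartPullbackWith_iso_of_compatibleAt (hℋiii : CompactInVerticialAt ℋ)`; the per-pair (R0′)/(R2′)
  of abc-iut-w4-d083 (`…R0CompatProofsAt` / `…R2bCompatProofsAt`) plug into the two remaining binders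
  by name;
* `base_eq_of_exists_chartPullbackWith_iso'` — (b)-uniqueness of the whole underlying morphism of
  semi-graphs, UNCONDITIONAL (the original `base_eq_of_exists_chartPullbackWith_iso` took (iii) for the
  edge map; abc-iut-w4-d083's `compatibleEdgeMapUnique_holds` has since removed that input).
* `cor39UpToTwistAt (h𝒢iii : CompactInVerticialAt 𝒢) (hℋiii : CompactInVerticialAt ℋ)` — THE PER-PAIR
  CLOSER OF RECORD (ruling α6-1): `cor39UpToTwist_of_R0_R2At` with its two binders discharged by
  abc-iut-w4-d083's per-pair (R0′) `isCompatiblyQuasiGeometric_of_compatAt` ((iii) at `𝒢`, Thm. 3.7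
  (iv) at `𝒢`, `ℋ` via abc-iut-w4-d075's `maximalCompactIffVerticialAt_of_compactInVerticialAt`) and
  (R2′) `quasiGeometricGraphDataCompatAt_of_compactInVerticialAt` ((iii) at `𝒢`, `ℋ`) — per-pair form
  of `cor39UpToTwist_of_compactInVerticial`, whose two inputs the finite-`𝔾` producer delivers
  (`compactInVerticialAt_of_finiteLevelData`); `cor39UpToTwist_baseAt` the same with FULL uniqueness of
  the underlying morphism of semi-graphs; named projections `isCompatiblyQuasiGeometric_of_exists_chartPullbackWith_isoAt`
  / `exists_hom_chartPullbackWith_iso_of_isCompatiblyQuasiGeometricAt` for consumers; `cor39UpToTwist_of_forall_compactInVerticialAt` the sanity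
  link back to the ∀-countable discharge.
Proof-only; the original file is untouched; nothing here asserts Thm. 3.7 (iii) for an infinite `𝔾`.
Nothing here takes a side on [IUTchIII] Cor. 3.12; typed ≠ discharged.
-/

open CategoryTheory

namespace Literature.AnabelianGeometry.SemiGraphs

namespace ProfiniteSemiGraph

universe u

variable {𝒢 ℋ : ProfiniteSemiGraph.{u}}

/-- **Cor. 3.9 (b), uniqueness of the underlying morphism of semi-graphs, UNCONDITIONAL** (def-free
currency): two locally open `F`, `F'` inducing the same `φ`, each for some family of conjugating
elements, have the same underlying `SemiGraph.Hom` — R1 (every `θ`) ×2 and abc-iut-w4-d083's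
`base_eq_of_compatV`. [cite: MochizukiSemiAnbd2006, Cor 3.9 p.43] -/
theorem base_eq_of_exists_chartPullbackWith_iso' (h𝒢 : Cor39Hypotheses 𝒢) (hℋ : Cor39Hypotheses ℋ)
    (c𝒢 : TemperedPiChart 𝒢) (cℋ : TemperedPiChart ℋ) (F F' : Hom 𝒢 ℋ) (φ : c𝒢.G →ₜ* cℋ.G)
    (hF : F.IsLocallyOpen) (hF' : F'.IsLocallyOpen)
    (hind : ∃ θ : F.ConjugatorFamily, Nonempty (F.chartPullbackWith θ c𝒢 cℋ ≅ BTemp.res φ))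
    (hind' : ∃ θ' : F'.ConjugatorFamily, Nonempty (F'.chartPullbackWith θ' c𝒢 cℋ ≅ BTemp.res φ)) :
    F'.base = F.base := by
  obtain ⟨θ, hθ⟩ := hind
  obtain ⟨θ', hθ'⟩ := hind'
  exact (base_eq_of_compatV h𝒢 hℋ c𝒢 cℋ hF hF' (F.compat_of_chartPullbackWith_iso θ c𝒢 cℋ φ hθ).1
    (F'.compat_of_chartPullbackWith_iso θ' c𝒢 cℋ φ hθ').1).symm

/-- **Cor. 3.9 up to twist at the pair `(G, H)` from its three steps at the pair** ((R0′), (R2′),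
(R3 `∃ θ`) as inline hypotheses; (a) = R1 ≫ R0′, (b)-existence = R2′ ≫ R3, (b)-uniqueness
unconditional). [cite: MochizukiSemiAnbd2006, Cor 3.9 pp.42-43] -/
theorem cor39UpToTwist_of_stepsAt (h𝒢 : Cor39Hypotheses 𝒢) (hℋ : Cor39Hypotheses ℋ)
    (c𝒢 : TemperedPiChart 𝒢) (cℋ : TemperedPiChart ℋ)
    (hR0 : ∀ (F : Hom 𝒢 ℋ) (φ : c𝒢.G →ₜ* cℋ.G), F.IsLocallyOpen → F.CompatV c𝒢 cℋ φ →
      F.CompatE c𝒢 cℋ φ → IsCompatiblyQuasiGeometric φ)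
    (hR2 : ∀ φ : c𝒢.G →ₜ* cℋ.G, IsCompatiblyQuasiGeometric φ →
      ∃ F : Hom 𝒢 ℋ, F.IsLocallyOpen ∧ F.CompatV c𝒢 cℋ φ ∧ F.CompatE c𝒢 cℋ φ)
    (hR3 : ∀ (F : Hom 𝒢 ℋ) (φ : c𝒢.G →ₜ* cℋ.G), F.IsLocallyOpen → F.CompatV c𝒢 cℋ φ →
      F.CompatE c𝒢 cℋ φ → ∃ θ : F.ConjugatorFamily, Nonempty (F.chartPullbackWith θ c𝒢 cℋ ≅ BTemp.res φ)) :
    (∀ (F : Hom 𝒢 ℋ), F.IsLocallyOpen → ∀ φ : c𝒢.G →ₜ* cℋ.G,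
        (∃ θ : F.ConjugatorFamily, Nonempty (F.chartPullbackWith θ c𝒢 cℋ ≅ BTemp.res φ)) →
          IsCompatiblyQuasiGeometric φ) ∧
      ∀ φ : c𝒢.G →ₜ* cℋ.G, IsCompatiblyQuasiGeometric φ →
        ∃ F : Hom 𝒢 ℋ, F.IsLocallyOpen ∧
          (∃ θ : F.ConjugatorFamily, Nonempty (F.chartPullbackWith θ c𝒢 cℋ ≅ BTemp.res φ)) ∧
          ∀ F' : Hom 𝒢 ℋ, F'.IsLocallyOpen →
            (∃ θ' : F'.ConjugatorFamily, Nonempty (F'.chartPullbackWith θ' c𝒢 cℋ ≅ BTemp.res φ)) →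
              F'.base.vertexMap = F.base.vertexMap ∧ F'.base.edgeMap = F.base.edgeMap := by
  refine ⟨fun F hF φ hind => ?_, fun φ hφ => ?_⟩
  · obtain ⟨θ, hθ⟩ := hind
    obtain ⟨hV, hE⟩ := F.compat_of_chartPullbackWith_iso θ c𝒢 cℋ φ hθ
    exact hR0 F φ hF hV hE
  · obtain ⟨F, hF, hV, hE⟩ := hR2 φ hφ
    refine ⟨F, hF, hR3 F φ hF hV hE, fun F' hF' hind' => ?_⟩
    have hb := base_eq_of_exists_chartPullbackWith_iso' h𝒢 hℋ c𝒢 cℋ F F' φ hF hF' (hR3 F φ hF hV hE)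
      hind'
    exact ⟨congrArg SemiGraph.Hom.vertexMap hb, congrArg SemiGraph.Hom.edgeMap hb⟩

/-- **Cor. 3.9 up to twist at the pair `(G, H)` with (R3) discharged by Thm. 3.7 (iii) AT `ℋ`**
(abc-iut-w4-d064's `chartPullbackWith_iso_of_compatibleAt`), from the per-pair (R0′) and (R2′) —
per-pair form of `cor39UpToTwist_of_compactInVerticial` up to those two inputs, which
abc-iut-w4-d083's per-pair R0′/R2′ discharge by name from `CompactInVerticialAt 𝒢`,
`CompactInVerticialAt ℋ`. [cite: MochizukiSemiAnbd2006, Cor 3.9 pp.42-43] -/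
theorem cor39UpToTwist_of_R0_R2At (hℋiii : CompactInVerticialAt ℋ) (h𝒢 : Cor39Hypotheses 𝒢)
    (hℋ : Cor39Hypotheses ℋ) (c𝒢 : TemperedPiChart 𝒢) (cℋ : TemperedPiChart ℋ)
    (hR0 : ∀ (F : Hom 𝒢 ℋ) (φ : c𝒢.G →ₜ* cℋ.G), F.IsLocallyOpen → F.CompatV c𝒢 cℋ φ →
      F.CompatE c𝒢 cℋ φ → IsCompatiblyQuasiGeometric φ)
    (hR2 : ∀ φ : c𝒢.G →ₜ* cℋ.G, IsCompatiblyQuasiGeometric φ →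
      ∃ F : Hom 𝒢 ℋ, F.IsLocallyOpen ∧ F.CompatV c𝒢 cℋ φ ∧ F.CompatE c𝒢 cℋ φ) :
    (∀ (F : Hom 𝒢 ℋ), F.IsLocallyOpen → ∀ φ : c𝒢.G →ₜ* cℋ.G,
        (∃ θ : F.ConjugatorFamily, Nonempty (F.chartPullbackWith θ c𝒢 cℋ ≅ BTemp.res φ)) →
          IsCompatiblyQuasiGeometric φ) ∧
      ∀ φ : c𝒢.G →ₜ* cℋ.G, IsCompatiblyQuasiGeometric φ →
        ∃ F : Hom 𝒢 ℋ, F.IsLocallyOpen ∧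
          (∃ θ : F.ConjugatorFamily, Nonempty (F.chartPullbackWith θ c𝒢 cℋ ≅ BTemp.res φ)) ∧
          ∀ F' : Hom 𝒢 ℋ, F'.IsLocallyOpen →
            (∃ θ' : F'.ConjugatorFamily, Nonempty (F'.chartPullbackWith θ' c𝒢 cℋ ≅ BTemp.res φ)) →
              F'.base.vertexMap = F.base.vertexMap ∧ F'.base.edgeMap = F.base.edgeMap :=
  cor39UpToTwist_of_stepsAt h𝒢 hℋ c𝒢 cℋ hR0 hR2 fun F φ hF hV hE =>
    chartPullbackWith_iso_of_compatibleAt hℋiii h𝒢 hℋ c𝒢 cℋ F φ hF hV hE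

/-! ### The per-pair closer of record -/

/-- **[SemiAnbd] Corollary 3.9 at the pair `(G, H)` over the compatible reading of Def. 3.8,
"induced" read up to the 2-cells of Rmk. 2.4.2, MODULO Theorem 3.7 (iii) AT `G` AND AT `H` ALONE**
— the per-pair closer of record (φ2-consumers twin of `cor39UpToTwist_of_compactInVerticial`, cell
ruling α6-1): (a) a homomorphism induced up to twist by a locally open morphism is compatibly
quasi-geometric; (b) every compatibly quasi-geometric homomorphism is so induced by a locally open
morphism whose vertex and edge maps are unique.  (R0′), (R2′) at the pair by abc-iut-w4-d083, (R3) at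
`ℋ` by abc-iut-w4-d064, Thm. 3.7 (iv) at a graph by abc-iut-w4-d075; both inputs are delivered for
finite `𝔾` by the finite-`𝔾` producer (`compactInVerticialAt_of_finiteLevelData`).  OUR rendering;
every step is a landed theorem. [cite: MochizukiSemiAnbd2006, Cor 3.9 pp.42-43] -/
theorem cor39UpToTwistAt (h𝒢iii : CompactInVerticialAt 𝒢) (hℋiii : CompactInVerticialAt ℋ)
    (h𝒢 : Cor39Hypotheses 𝒢) (hℋ : Cor39Hypotheses ℋ) (c𝒢 : TemperedPiChart 𝒢)
    (cℋ : TemperedPiChart ℋ) :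
    (∀ (F : Hom 𝒢 ℋ), F.IsLocallyOpen → ∀ φ : c𝒢.G →ₜ* cℋ.G,
        (∃ θ : F.ConjugatorFamily, Nonempty (F.chartPullbackWith θ c𝒢 cℋ ≅ BTemp.res φ)) →
          IsCompatiblyQuasiGeometric φ) ∧
      ∀ φ : c𝒢.G →ₜ* cℋ.G, IsCompatiblyQuasiGeometric φ →
        ∃ F : Hom 𝒢 ℋ, F.IsLocallyOpen ∧
          (∃ θ : F.ConjugatorFamily, Nonempty (F.chartPullbackWith θ c𝒢 cℋ ≅ BTemp.res φ)) ∧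
          ∀ F' : Hom 𝒢 ℋ, F'.IsLocallyOpen →
            (∃ θ' : F'.ConjugatorFamily, Nonempty (F'.chartPullbackWith θ' c𝒢 cℋ ≅ BTemp.res φ)) →
              F'.base.vertexMap = F.base.vertexMap ∧ F'.base.edgeMap = F.base.edgeMap :=
  cor39UpToTwist_of_R0_R2At hℋiii h𝒢 hℋ c𝒢 cℋ
    (fun F φ hF hV hE => isCompatiblyQuasiGeometric_of_compatAt verticialInjective_holds
      verticialDistinct_holds h𝒢iii (maximalCompactIffVerticialAt_of_compactInVerticialAt h𝒢iii)
      (maximalCompactIffVerticialAt_of_compactInVerticialAt hℋiii) h𝒢 hℋ c𝒢 cℋ F φ hF hV hE)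
    (fun φ hφ => quasiGeometricGraphDataCompatAt_of_compactInVerticialAt h𝒢iii hℋiii h𝒢 hℋ c𝒢 cℋ φ hφ)

/-- **Cor. 3.9 (a) at the pair, modulo Thm. 3.7 (iii) AT `G` and AT `H`** (named projection of
`cor39UpToTwistAt` for consumers; per-pair form of `isCompatiblyQuasiGeometric_of_exists_chartPullbackWith_iso`):
a homomorphism induced up to twist by a locally open `F : G → H` is compatibly quasi-geometric.
[cite: MochizukiSemiAnbd2006, Cor 3.9 pp.42-43] -/
theorem isCompatiblyQuasiGeometric_of_exists_chartPullbackWith_isoAt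
    (h𝒢iii : CompactInVerticialAt 𝒢) (hℋiii : CompactInVerticialAt ℋ) (h𝒢 : Cor39Hypotheses 𝒢)
    (hℋ : Cor39Hypotheses ℋ) (c𝒢 : TemperedPiChart 𝒢) (cℋ : TemperedPiChart ℋ) (F : Hom 𝒢 ℋ)
    (φ : c𝒢.G →ₜ* cℋ.G) (hF : F.IsLocallyOpen)
    (hind : ∃ θ : F.ConjugatorFamily, Nonempty (F.chartPullbackWith θ c𝒢 cℋ ≅ BTemp.res φ)) :
    IsCompatiblyQuasiGeometric φ :=
  (cor39UpToTwistAt h𝒢iii hℋiii h𝒢 hℋ c𝒢 cℋ).1 F hF φ hind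

/-- **Cor. 3.9 (b), existence, at the pair, modulo Thm. 3.7 (iii) AT `G` and AT `H`** (named
projection of `cor39UpToTwistAt` for consumers, e.g. the [SemiAnbd] Thm. 5.4 chain; per-pair form of
`exists_hom_chartPullbackWith_iso_of_isCompatiblyQuasiGeometric`): every compatibly quasi-geometric `φ`
is induced, for some family `θ` of conjugating elements, by a locally open morphism `F : G → H`.
[cite: MochizukiSemiAnbd2006, Cor 3.9 pp.42-43] -/
theorem exists_hom_chartPullbackWith_iso_of_isCompatiblyQuasiGeometricAt
    (h𝒢iii : CompactInVerticialAt 𝒢) (hℋiii : CompactInVerticialAt ℋ) (h𝒢 : Cor39Hypotheses 𝒢)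
    (hℋ : Cor39Hypotheses ℋ) (c𝒢 : TemperedPiChart 𝒢) (cℋ : TemperedPiChart ℋ)
    (φ : c𝒢.G →ₜ* cℋ.G) (hφ : IsCompatiblyQuasiGeometric φ) :
    ∃ F : Hom 𝒢 ℋ, F.IsLocallyOpen ∧
      ∃ θ : F.ConjugatorFamily, Nonempty (F.chartPullbackWith θ c𝒢 cℋ ≅ BTemp.res φ) := by
  obtain ⟨F, hF, hind, -⟩ := (cor39UpToTwistAt h𝒢iii hℋiii h𝒢 hℋ c𝒢 cℋ).2 φ hφ
  exact ⟨F, hF, hind⟩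

/-- **The same with FULL uniqueness of the underlying morphism of semi-graphs** (vertex, edge AND
branch maps: `base_eq_of_exists_chartPullbackWith_iso'`), modulo Thm. 3.7 (iii) AT `G` and AT `H`.
[cite: MochizukiSemiAnbd2006, Cor 3.9 pp.42-43] -/
theorem cor39UpToTwist_baseAt (h𝒢iii : CompactInVerticialAt 𝒢) (hℋiii : CompactInVerticialAt ℋ)
    (h𝒢 : Cor39Hypotheses 𝒢) (hℋ : Cor39Hypotheses ℋ) (c𝒢 : TemperedPiChart 𝒢)
    (cℋ : TemperedPiChart ℋ) :
    (∀ (F : Hom 𝒢 ℋ), F.IsLocallyOpen → ∀ φ : c𝒢.G →ₜ* cℋ.G,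
        (∃ θ : F.ConjugatorFamily, Nonempty (F.chartPullbackWith θ c𝒢 cℋ ≅ BTemp.res φ)) →
          IsCompatiblyQuasiGeometric φ) ∧
      ∀ φ : c𝒢.G →ₜ* cℋ.G, IsCompatiblyQuasiGeometric φ →
        ∃ F : Hom 𝒢 ℋ, F.IsLocallyOpen ∧
          (∃ θ : F.ConjugatorFamily, Nonempty (F.chartPullbackWith θ c𝒢 cℋ ≅ BTemp.res φ)) ∧
          ∀ F' : Hom 𝒢 ℋ, F'.IsLocallyOpen →
            (∃ θ' : F'.ConjugatorFamily, Nonempty (F'.chartPullbackWith θ' c𝒢 cℋ ≅ BTemp.res φ)) →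
              F'.base = F.base := by
  refine ⟨(cor39UpToTwistAt h𝒢iii hℋiii h𝒢 hℋ c𝒢 cℋ).1, fun φ hφ => ?_⟩
  obtain ⟨F, hF, hind, -⟩ := (cor39UpToTwistAt h𝒢iii hℋiii h𝒢 hℋ c𝒢 cℋ).2 φ hφ
  exact ⟨F, hF, hind, fun F' hF' hind' =>
    base_eq_of_exists_chartPullbackWith_iso' h𝒢 hℋ c𝒢 cℋ F F' φ hF hF' hind hind'⟩

/-- Sanity link: the ∀-countable discharge `cor39UpToTwist_of_compactInVerticial` is, pairwise, the
per-graph one (Thm. 3.7 (iii) at EVERY graph ⇒ the correspondence at every pair).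
[cite: MochizukiSemiAnbd2006, Cor 3.9 pp.42-43] -/
theorem cor39UpToTwist_of_forall_compactInVerticialAt
    (h : ∀ 𝒢 : ProfiniteSemiGraph.{u}, CompactInVerticialAt 𝒢) (𝒢 ℋ : ProfiniteSemiGraph.{u})
    (h𝒢 : Cor39Hypotheses 𝒢) (hℋ : Cor39Hypotheses ℋ) (c𝒢 : TemperedPiChart 𝒢)
    (cℋ : TemperedPiChart ℋ) :
    (∀ (F : Hom 𝒢 ℋ), F.IsLocallyOpen → ∀ φ : c𝒢.G →ₜ* cℋ.G,
        (∃ θ : F.ConjugatorFamily, Nonempty (F.chartPullbackWith θ c𝒢 cℋ ≅ BTemp.res φ)) →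
          IsCompatiblyQuasiGeometric φ) ∧
      ∀ φ : c𝒢.G →ₜ* cℋ.G, IsCompatiblyQuasiGeometric φ →
        ∃ F : Hom 𝒢 ℋ, F.IsLocallyOpen ∧
          (∃ θ : F.ConjugatorFamily, Nonempty (F.chartPullbackWith θ c𝒢 cℋ ≅ BTemp.res φ)) ∧
          ∀ F' : Hom 𝒢 ℋ, F'.IsLocallyOpen →
            (∃ θ' : F'.ConjugatorFamily, Nonempty (F'.chartPullbackWith θ' c𝒢 cℋ ≅ BTemp.res φ)) →
              F'.base.vertexMap = F.base.vertexMap ∧ F'.base.edgeMap = F.base.edgeMap :=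
  cor39UpToTwistAt (h 𝒢) (h ℋ) h𝒢 hℋ c𝒢 cℋ

end ProfiniteSemiGraph

end Literature.AnabelianGeometry.SemiGraphs
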